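import Literature.NumberTheory.Sieve.LevelOfDistribution
import HarnessLib

/-!
# Bombieri–Friedlander–Iwaniec II (1987), Main Theorem: primes in progressions for a FIXED residue,
# dyadic moduli up to `Q² ≤ xy` — named fact

Topic `Literature/NumberTheory/Sieve`; cite item `wi-41677` (route `Parity/TradeoffLineLevelHalf`,
item `PrimeSideLevelHalf` stmt-Parity-19553, skeleton `stub_window`: the prime-side window
`√x/(log x)^B < m ≤ √x (log x)^C`).  Only the first paper of the series (Acta Math. 156 (1986):
Theorems 0b, 1, 2, 5, 5*, 10, `BombieriFriedlanderIwaniec*.lean`) was vendored so far.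

## Source

E. Bombieri, J. B. Friedlander, H. Iwaniec, *Primes in arithmetic progressions to large moduli.
II*, Math. Ann. 277 (1987), 361–393 [BombieriFriedlanderIwaniec1987], Main Theorem, display
(1.5), pp. 362–363: for `a ≠ 0`, `x ≥ y ≥ 3` and `Q² ≤ xy`,
`∑_{Q ≤ q < 2Q, (q,a)=1} |ψ(x; q, a) − x/φ(q)| ≪ x (log y / log x)² (log log x)^B`,
with `B` a constant and the implied constant depending on `a` only.  Restated verbatim (block
`Q ≤ q < 2Q`) as D. Fiorilli, *On a theorem of Bombieri, Friedlander, and Iwaniec*, Canad. J.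
Math. 64 (2012), Thm. 1.1 [Fiorilli2012] (arXiv:1108.0439 p. 3, read).  The statements of BFI II
are unaffected by the authors' later corrections to the Acta paper (Bombieri–Friedlander–Iwaniec,
*Some corrections to an old paper*, arXiv:1903.01371, p. 1: "The contents of our two sequel papers
[BFI2, BFI3] also remain unchanged").  The Math. Ann. text itself is cite-only in the store
(acq-01960); the sourcing note attached to `wi-41677` (GDZ scan pp. 362–363 read by an earlier
seat) records the block convention `Q ≤ q < 2Q`, `B` absolute and the constant depending on `a`
alone.

## Rendering

* `ψ(x; q, a) = LevelOfDistribution.chebyshevPsiMod q (a : ZMod q) x` and `φ = Nat.totient`, as in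
  the vendored Theorem 10 of the Acta paper (`BombieriFriedlanderIwaniecTheorem10`).
* The dyadic block `Q ≤ q < 2Q`, `(q, a) = 1`: naturals `q < ⌈2Q⌉₊` (i.e. `q < 2Q`) with
  `Q ≤ q` and `IsCoprime (q : ℤ) a`; empty for `Q ≤ 0`.
* `≪` with constants depending on `a`: for each `a ≠ 0` there are reals `B` and `C` (BOTH allowed
  to depend on `a` — weaker than the printed "B absolute") such that the bound holds with
  `C · x · (log y/log x)² · (log log x)^B` for ALL `x ≥ y ≥ 3`, `Q² ≤ xy` (no threshold in `x`, as
  printed; `log log x > 0` for `x ≥ 3`).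
* The name asked for by the route (`BFI2FixedResidue`) is this declaration.

Statement only (Linnik's dispersion method with Deshouillers–Iwaniec's bounds for sums of
Kloosterman sums; not in Mathlib).
-/

noncomputable section

open Finset

namespace Literature.NumberTheory.Sieve

/-- **Bombieri–Friedlander–Iwaniec 1987 (part II), Main Theorem** (Math. Ann. 277, (1.5),
pp. 362–363; = Fiorilli 2012, Thm. 1.1): for every integer `a ≠ 0` there are constants `B` and `C`
(depending on `a` only) such that for all reals `x ≥ y ≥ 3` and `Q` with `Q² ≤ x y`,
`∑_{Q ≤ q < 2Q, (q, a) = 1} |ψ(x; q, a) − x/φ(q)| ≤ C · x · (log y / log x)² · (log log x)^B`.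
(Printed: `≪` with the implied constant depending on `a` alone and `B` a constant; here both may
depend on `a`.)  `ψ(x; q, a) = LevelOfDistribution.chebyshevPsiMod q a x`.  Taking `y` a power of
`log x` gives moduli `Q = x^{1/2} (log x)^{C'}` with a saving `(log log x)^{B+2}/(log x)²` — "by
fixing `a`, one can go up to `Q = x^{1/2 + 1/(log log x)^B}`" (Fiorilli).  Statement only; users take
`(h : BombieriFriedlanderIwaniec1987MainTheorem)`.
[cite: BombieriFriedlanderIwaniec1987, Main Theorem (1.5), pp. 362–363]
[cite: Fiorilli2012, Thm. 1.1] -/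
def BombieriFriedlanderIwaniec1987MainTheorem : Prop :=
  ∀ a : ℤ, a ≠ 0 → ∃ B C : ℝ, ∀ x y Q : ℝ, 3 ≤ y → y ≤ x → Q ^ 2 ≤ x * y →
    ∑ q ∈ (range ⌈2 * Q⌉₊).filter (fun q : ℕ => Q ≤ (q : ℝ) ∧ IsCoprime (q : ℤ) a),
        |LevelOfDistribution.chebyshevPsiMod q (a : ZMod q) x - x / Nat.totient q| ≤
      C * x * (Real.log y / Real.log x) ^ 2 * Real.log (Real.log x) ^ B

/-- The block of moduli is what it should be: a natural `q` is summed iff `Q ≤ q < 2Q` and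
`(q, a) = 1`. [cite: BombieriFriedlanderIwaniec1987, Main Theorem (1.5) (range of summation)] -/
theorem mem_bfi2Block_iff {a : ℤ} {Q : ℝ} {q : ℕ} :
    q ∈ (range ⌈2 * Q⌉₊).filter (fun q : ℕ => Q ≤ (q : ℝ) ∧ IsCoprime (q : ℤ) a) ↔
      Q ≤ (q : ℝ) ∧ (q : ℝ) < 2 * Q ∧ IsCoprime (q : ℤ) a := by
  rw [mem_filter, mem_range, Nat.lt_ceil]
  tauto

/-- The constant `C` may be taken nonnegative and `B` unchanged (cosmetic normalisation: the
left-hand side is a sum of absolute values). [cite: BombieriFriedlanderIwaniec1987, Main Theorem (1.5)] -/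
theorem BombieriFriedlanderIwaniec1987MainTheorem.exists_nonneg
    (h : BombieriFriedlanderIwaniec1987MainTheorem) {a : ℤ} (ha : a ≠ 0) :
    ∃ B C : ℝ, 0 ≤ C ∧ ∀ x y Q : ℝ, 3 ≤ y → y ≤ x → Q ^ 2 ≤ x * y →
      ∑ q ∈ (range ⌈2 * Q⌉₊).filter (fun q : ℕ => Q ≤ (q : ℝ) ∧ IsCoprime (q : ℤ) a),
          |LevelOfDistribution.chebyshevPsiMod q (a : ZMod q) x - x / Nat.totient q| ≤
        C * x * (Real.log y / Real.log x) ^ 2 * Real.log (Real.log x) ^ B := by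
  obtain ⟨B, C, hC⟩ := h a ha
  refine ⟨B, max C 0, le_max_right _ _, fun x y Q hy hyx hQ => (hC x y Q hy hyx hQ).trans ?_⟩
  have hx : 0 ≤ x := by linarith
  have hlog : 1 ≤ Real.log x := by
    have h3 : Real.exp 1 ≤ x := by
      have := Real.exp_one_lt_d9
      linarith
    have := Real.log_le_log (Real.exp_pos 1) h3
    rwa [Real.log_exp] at this
  have hll : 0 ≤ Real.log (Real.log x) ^ B :=
    Real.rpow_nonneg (Real.log_nonneg hlog) B
  have hmid : 0 ≤ x * (Real.log y / Real.log x) ^ 2 * Real.log (Real.log x) ^ B :=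
    mul_nonneg (mul_nonneg hx (sq_nonneg _)) hll
  calc C * x * (Real.log y / Real.log x) ^ 2 * Real.log (Real.log x) ^ B
      = C * (x * (Real.log y / Real.log x) ^ 2 * Real.log (Real.log x) ^ B) := by ring
    _ ≤ max C 0 * (x * (Real.log y / Real.log x) ^ 2 * Real.log (Real.log x) ^ B) :=
        mul_le_mul_of_nonneg_right (le_max_left _ _) hmid
    _ = max C 0 * x * (Real.log y / Real.log x) ^ 2 * Real.log (Real.log x) ^ B := by ring

end Literature.NumberTheory.Sieve

end
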